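import Literature.RepresentationTheory.FiniteGroups.StableLatticeReductionInvariantInt
import Mathlib.LinearAlgebra.Isomorphisms
import HarnessLib

/-!
# Exact pieces of an additive invariant of finite `p`-torsion `ℤ[Δ]`-modules, instance-polymorphic form
# (Serre §15.2 Thm. 32 calculus; the reading of `P →(p) P → Q → T →(p) T` through `ψ`)

Topic `RepresentationTheory/FiniteGroups`; namespace
`Literature.RepresentationTheory.FiniteGroups.StableLatticeReduction.Poly`.  THEOREMS ONLY (no
definition, no named fact, no `sorry`, no instance).  Companion of `StableLatticeReductionInvariantInt`
(binder pair `(ψ, hψ)`: a function `ψ` on `ℤ`-linear representations of a monoid `Δ`, additive on short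
exact sequences whose middle term is finite and killed by `p`) for modules whose `Module ℤ` structure
is NOT the canonical `AddCommGroup.toIntModule` — the situation of the continuous-cohomology groups
`Hⁿ(G, M)` of the tree (carriers of `TopModuleCat` objects, `Module ℤ` = `ModuleCat.isModule`), on
which the `Δ = G/W`-representations `ContinuousRep.coindOpenHRep` of lane «TATE-EPC-TC» live.

Design (forced by elaboration, recorded here once):
* every statement is INSTANCE-POLYMORPHIC (`[AddCommGroup X] [Module ℤ X]`, arbitrary instance);
* in `ψ` the instance binders are strict-implicit, `∀ ⦃X : Type u⦄ ⦃_ : AddCommGroup X⦄ ⦃_ : Module ℤ X⦄,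
  Representation ℤ Δ X → A` — the SAME Π-type as the B3a-β binder (binder annotations are not part of
  the type; a consumer's instance-implicit `ψ`, `hψ` are accepted verbatim), but `ψ ρ` then takes its
  instances from `ρ` by unification instead of type-class resolution (which would pick
  `AddCommGroup.toIntModule` on a subtype and mismatch `Submodule.module`);
* `p`-torsion conditions are phrased with the additive group's `ℤ`-action `(p : ℤ) • y` (as in `hψ`),
  and "the `p`-multiples of `P`" / "the `p`-torsion of `T`" enter only through membership
  characterisations of submodules `N` supplied by the consumer (any spelling: `torsionBy`,
  `(p : ℤ) • ⊤`, `LinearMap.ker (p • LinearMap.id)`, …).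

* `finite_of_exact` — a module sitting in `P′ → Q → T′` with `ker ⊆ im`, `P′` and the image finite, is finite;
* `additive_subrepresentation_eq_of_linearEquiv`, `additive_quotient_eq_of_linearEquiv` — transport of
  `ψ(N)`, `ψ(X/N)` along an equivariant isomorphism carrying `N` onto `N′`;
* **`additive_eq_quotient_add_subrepresentation_of_exact`** — equivariant `δ : P → Q`, `f : Q → T` with
  `ker δ = N_P`, `im δ = ker f`, `im f = N_T`, `Q` finite killed by `p` ⟹ `ψ(Q) = ψ(P/N_P) + ψ(N_T)`.

Lane «TATE-EPC-TC» of cell `bsd-eis` (crux `GoodLatticeBDPValue`, stmt-BirchSwinnertonDyer-19032), brick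
B8-arith ≡ B6b, generic part; consumed by `NumberTheory/GaloisRepresentations/CoinducedKummerSequencePieces`.
HONEST FRAMING: module-theoretic bookkeeping only; no arithmetic statement and no case of BSD is proved here.

## References
* J.-P. Serre, *Représentations linéaires des groupes finis* (1977), §15.2 Thm. 32. [SerreLinearRepresentations1977]
* J. S. Milne, *Arithmetic Duality Theorems*, 2nd ed. (2006), I Lemma 2.12, §5. [MilneADT2006]
* J. Neukirch, A. Schmidt, K. Wingberg, *Cohomology of Number Fields*, 2nd ed. (2008), (1.3.2). [NeukirchSchmidtWingberg2008]
-/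

open Function LinearMap Submodule
open scoped Pointwise

universe u

namespace Literature.RepresentationTheory.FiniteGroups

namespace StableLatticeReduction.Poly

open Literature.RepresentationTheory.FiniteGroups.StableLatticeReduction
  (smul_top_le_comap torsionBy_le_comap ker_le_comap_of_comm range_le_comap_of_comm subrepresentation_congr)
open Literature.RepresentationTheory.FiniteGroups.StableLatticeReduction.Int (admissible)


variable {Δ : Type*} [Monoid Δ] {A : Type*} [AddCommGroup A] {p : ℕ}

/-- **A module between two finite ones is finite**: if `δ : P' → Q` and `f : Q → T'` are additive
maps with `ker f ⊆ im δ`, `P'` and the image of `f` finite, then `Q` is finite (the finiteness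
bookkeeping along an exact `P′ → Q → T′`). [cite: MilneADT2006, I §5 (proof of Thm. 5.1, finiteness of the cohomology groups along the Kummer sequence)] -/
theorem finite_of_exact {P' Q T' : Type*} [AddCommGroup P'] [AddCommGroup Q] [AddCommGroup T']
    (δ : P' →+ Q) (f : Q →+ T') [Finite P'] [Finite (AddMonoidHom.range f)]
    (hex : ∀ q, f q = 0 → ∃ x, δ x = q) : Finite Q := by
  classical
  -- a section of `f` over its range
  choose s hs using fun t : AddMonoidHom.range f => (AddMonoidHom.mem_range.1 t.2)
  refine Finite.of_surjective (fun xt : P' × AddMonoidHom.range f => δ xt.1 + s xt.2) fun q => ?_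
  have hq : f (q - s ⟨f q, ⟨q, rfl⟩⟩) = 0 := by rw [map_sub, hs, sub_self]
  obtain ⟨x, hx⟩ := hex _ hq
  exact ⟨(x, ⟨f q, ⟨q, rfl⟩⟩), by simp only [hx, sub_add_cancel]⟩

/-! The binder pair `(ψ, hψ)` below is that of `StableLatticeReductionInvariantInt` (additivity on short
exact sequences of finite `ℤ[Δ]`-modules killed by `p`); in `ψ` the instance binders are written
strict-implicit (`⦃_ : AddCommGroup X⦄ ⦃_ : Module ℤ X⦄`), which is the SAME Π-type (binder
annotations are not part of the type: a consumer's `ψ`, `hψ` with instance-implicit binders are accepted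
verbatim) but makes `ψ ρ` elaborate its instances by unification from `ρ` — necessary for the
representations on sub- and quotient modules of the continuous-cohomology carriers, whose `Module ℤ`
structure (`ModuleCat.isModule`) is not the one type-class resolution finds on a subtype
(`AddCommGroup.toIntModule`).  All `p`-torsion conditions are stated with the `ℤ`-scalar multiplication
of the additive group (`(p : ℤ) • y`, as in `hψ`), and the `p`-torsion / `p`-multiple submodules enter
only through membership characterisations (`hN`), so that no particular spelling (`torsionBy`,
`(p : ℤ) • ⊤`, `LinearMap.ker (p • LinearMap.id)`, …) is forced on consumers. -/

variable (ψ : ∀ ⦃X : Type u⦄ ⦃_ : AddCommGroup X⦄ ⦃_ : Module ℤ X⦄, Representation ℤ Δ X → A)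
  (hψ : ∀ ⦃X Y Z : Type u⦄ [AddCommGroup X] [Module ℤ X] [AddCommGroup Y] [Module ℤ Y]
    [AddCommGroup Z] [Module ℤ Z] (ρX : Representation ℤ Δ X) (ρY : Representation ℤ Δ Y)
    (ρZ : Representation ℤ Δ Z) (f : X →ₗ[ℤ] Y) (g : Y →ₗ[ℤ] Z),
    (∀ s x, f (ρX s x) = ρY s (f x)) → (∀ s y, g (ρY s y) = ρZ s (g y)) →
    Injective f → Surjective g → LinearMap.range f = LinearMap.ker g → Finite Y →
    (∀ y : Y, (p : ℤ) • y = 0) → ψ ρY = ψ ρX + ψ ρZ)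
include hψ

/-- **Transport of `ψ` of a subrepresentation along an equivariant isomorphism** `e : X ≃ X′`
carrying the stable submodule `N ⊆ X` onto `N′ ⊆ X′`: `ψ(N) = ψ(N′)` (`N′` finite, killed by `p`).
[cite: SerreLinearRepresentations1977, §15.2 Thm. 32] -/
theorem additive_subrepresentation_eq_of_linearEquiv {X X' : Type u} [AddCommGroup X] [Module ℤ X]
    [AddCommGroup X'] [Module ℤ X'] (ρX : Representation ℤ Δ X) (ρX' : Representation ℤ Δ X')
    (N : Submodule ℤ X) (hNst : ∀ s, N ≤ N.comap (ρX s)) (N' : Submodule ℤ X')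
    (hN'st : ∀ s, N' ≤ N'.comap (ρX' s)) (e : X ≃ₗ[ℤ] X') (he : ∀ s x, e (ρX s x) = ρX' s (e x))
    (hmem : ∀ x, e x ∈ N' ↔ x ∈ N) [Finite N'] (htor : ∀ y : N', (p : ℤ) • y = 0) :
    ψ (ρX.subrepresentation N hNst) = ψ (ρX'.subrepresentation N' hN'st) := by
  letI : Module ℤ N := N.module
  letI : Module ℤ N' := N'.module
  obtain ⟨-, good_quot, hψ'⟩ := admissible ψ hψ
  have hmap : N.map (e : X →ₗ[ℤ] X') = N' := by
    ext x'
    rw [Submodule.mem_map]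
    constructor
    · rintro ⟨x, hx, rfl⟩
      exact (hmem x).2 hx
    · intro hx'
      refine ⟨e.symm x', ?_, e.apply_symm_apply x'⟩
      rw [← hmem, LinearEquiv.apply_symm_apply]; exact hx'
  letI : Module ℤ (N.map (e : X →ₗ[ℤ] X')) := (N.map (e : X →ₗ[ℤ] X')).module
  refine Admissible.additive_eq_of_linearEquiv ψ _ good_quot hψ' _ _ ⟨‹_›, htor⟩
    ((e.submoduleMap N).trans (LinearEquiv.ofEq _ _ hmap)) (fun s x => ?_)
  apply Subtype.ext
  change ((LinearEquiv.ofEq _ _ hmap (e.submoduleMap N (ρX.subrepresentation N hNst s x)) : N') : X') =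
    ρX' s ((LinearEquiv.ofEq _ _ hmap (e.submoduleMap N x) : N') : X')
  rw [LinearEquiv.coe_ofEq_apply, LinearEquiv.coe_ofEq_apply, LinearEquiv.submoduleMap_apply,
    LinearEquiv.submoduleMap_apply]
  exact he s x

/-- **Transport of `ψ` of a quotient representation along an equivariant isomorphism** `e : X ≃ X′`
carrying `N ⊆ X` onto `N′ ⊆ X′`: `ψ(X/N) = ψ(X′/N′)` (`X′/N′` finite, killed by `p`).
[cite: SerreLinearRepresentations1977, §15.2 Thm. 32] -/
theorem additive_quotient_eq_of_linearEquiv {X X' : Type u} [AddCommGroup X] [Module ℤ X]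
    [AddCommGroup X'] [Module ℤ X'] (ρX : Representation ℤ Δ X) (ρX' : Representation ℤ Δ X')
    (N : Submodule ℤ X) (hNst : ∀ s, N ≤ N.comap (ρX s)) (N' : Submodule ℤ X')
    (hN'st : ∀ s, N' ≤ N'.comap (ρX' s)) (e : X ≃ₗ[ℤ] X') (he : ∀ s x, e (ρX s x) = ρX' s (e x))
    (hmem : ∀ x, e x ∈ N' ↔ x ∈ N) [Finite (X' ⧸ N')] (htor : ∀ y : X' ⧸ N', (p : ℤ) • y = 0) :
    ψ (ρX.quotient N hNst) = ψ (ρX'.quotient N' hN'st) := by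
  letI : Module ℤ (X ⧸ N) := Submodule.Quotient.module N
  letI : Module ℤ (X' ⧸ N') := Submodule.Quotient.module N'
  obtain ⟨-, good_quot, hψ'⟩ := admissible ψ hψ
  have hmap : N.map (e : X →ₗ[ℤ] X') = N' := by
    ext x'
    rw [Submodule.mem_map]
    constructor
    · rintro ⟨x, hx, rfl⟩
      exact (hmem x).2 hx
    · intro hx'
      refine ⟨e.symm x', ?_, e.apply_symm_apply x'⟩
      rw [← hmem, LinearEquiv.apply_symm_apply]; exact hx'
  refine Admissible.additive_eq_of_linearEquiv ψ _ good_quot hψ' _ _ ⟨‹_›, htor⟩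
    (Submodule.Quotient.equiv N N' e hmap) (fun s q => ?_)
  obtain ⟨x, rfl⟩ := Submodule.mkQ_surjective _ q
  change (Submodule.Quotient.mk (e (ρX s x)) : X' ⧸ N') = Submodule.Quotient.mk (ρX' s (e x))
  rw [he]

/-- **The Kummer piece in `ψ`-form**: for `Δ`-equivariant `ℤ`-linear maps `δ : P → Q`, `f : Q → T`
with `ker δ = N_P` (the `p`-multiples of `P`), `im δ = ker f` and `im f = N_T` (the `p`-torsion of
`T`), and `Q` finite killed by `p`: `ψ(Q) = ψ(P/N_P) + ψ(N_T)` — the reading of an exact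
`P →(p) P →δ Q →f T →(p) T` through an additive invariant.  The submodules `N_P`, `N_T` enter only
through the exactness hypotheses `hker`, `hrange` (any spelling of "`pP`", "`T[p]`").
[cite: NeukirchSchmidtWingberg2008, (1.3.2)] [cite: Greenberg2006, §3 B (5)] -/
theorem additive_eq_quotient_add_subrepresentation_of_exact {P Q T : Type u} [AddCommGroup P]
    [Module ℤ P] [AddCommGroup Q] [Module ℤ Q] [AddCommGroup T] [Module ℤ T]
    (ρP : Representation ℤ Δ P) (ρQ : Representation ℤ Δ Q) (ρT : Representation ℤ Δ T)
    (δ : P →ₗ[ℤ] Q) (f : Q →ₗ[ℤ] T)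
    (hδ : ∀ s x, δ (ρP s x) = ρQ s (δ x)) (hf : ∀ s y, f (ρQ s y) = ρT s (f y))
    (NP : Submodule ℤ P) (hNPst : ∀ s, NP ≤ NP.comap (ρP s))
    (NT : Submodule ℤ T) (hNTst : ∀ s, NT ≤ NT.comap (ρT s))
    (hker : ∀ x, δ x = 0 ↔ x ∈ NP) (hex : ∀ q, f q = 0 ↔ ∃ x, δ x = q)
    (hrange : ∀ t, (∃ q, f q = t) ↔ t ∈ NT) [Finite Q] (hQ : ∀ q : Q, (p : ℤ) • q = 0) :
    ψ ρQ = ψ (ρP.quotient NP hNPst) + ψ (ρT.subrepresentation NT hNTst) := by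
  letI : Module ℤ (P ⧸ NP) := Submodule.Quotient.module NP
  letI : Module ℤ (LinearMap.ker f) := (LinearMap.ker f).module
  obtain ⟨good_sub, good_quot, hψ'⟩ := admissible ψ hψ
  -- `ψ Q = ψ (ker f) + ψ (range f)`
  rw [Admissible.additive_eq_ker_add_range ψ _ hψ' ρQ ρT ⟨‹_›, hQ⟩ f hf]
  congr 1
  · -- `ker f ≅ P/N_P` through `δ`
    have hkerδ : LinearMap.ker δ = NP := by
      ext x; exact hker x
    have hrangeδ : LinearMap.range δ = LinearMap.ker f := by
      ext q
      rw [LinearMap.mem_range, LinearMap.mem_ker]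
      exact ⟨fun ⟨x, hx⟩ => (hex q).2 ⟨x, hx⟩, fun hq => (hex q).1 hq⟩
    let e : (P ⧸ NP) ≃ₗ[ℤ] LinearMap.ker f :=
      (Submodule.quotEquivOfEq _ _ hkerδ.symm).trans
        ((LinearMap.quotKerEquivRange δ).trans (LinearEquiv.ofEq _ _ hrangeδ))
    symm
    refine Admissible.additive_eq_of_linearEquiv ψ _ good_quot hψ' _ _
      (good_sub ρQ _ (ker_le_comap_of_comm ρQ ρT f hf) ⟨‹_›, hQ⟩) e (fun s x => ?_)
    obtain ⟨x, rfl⟩ := Submodule.mkQ_surjective _ x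
    apply Subtype.ext
    change δ (ρP s x) = ρQ s (δ x)
    exact hδ s x
  · -- `range f = N_T`
    exact subrepresentation_congr ψ ρT (by
      ext t
      rw [LinearMap.mem_range]
      exact hrange t) _ _

end StableLatticeReduction.Poly

end Literature.RepresentationTheory.FiniteGroups
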